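import Summits.Ventures.Crystal3D.Theorems.StickyWulffConstantCoaxialWallLawPayerFamilyEnds
import HarnessLib

/-!
# End accounting, census-free, multi-source I′: the END PAIRS of one word family — top exclusion in CERTIFIED-STATE form

HONEST FRAMING. Part of the venture `Summits/Ventures/Crystal3D` (cell `crystal3d-full`), helper for the crux
`CoaxialWallLaw` (stmt-Ventures-19481) of `route-Ventures-StickyWulffConstant`, REGISTERED line `WallLedgerF`
(planner cf-p1), open stub `stub_coaxialTwoSlabAdhesion` (general fillings).  Rung credit only; F-C1 not moved.
Brick (B3b′) of memo HOME/wall-19481-p2/F-MULTISOURCE.md (19481-p2 g4): the text of `word_family_endPairs`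
(`…PayerFamilyEnds`) with the top exclusion weakened from «invariant states avoid the top sample» to the form the
abstract count actually consumes — «an invariant, CERTIFIED state (occupied slot triangle) never sits on a ball of the top
sample with a full top-frame shell» — so that the IN-PLANE twin families (exclusion by `word_noTop_of_inner_zero`, not by
a position invariant) are covered by the same export:

**Theorem (`word_family_endPairs`).**  Same hypotheses (one root `u []`, word data `F, u, WF, next`, state invariant
`P`, top frame `G₂`, two-slab cell; `KissingGap δ`, `KissingClassification δ`).  There is a finite set `T` of pairs
`(b, q)` with: `#sources ≤ #T + 220·#rim_top + 220·#rim_bottom`; every pair has `b, q ∈ X`, `dist b q = 1`, `b` in the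
window; every end ball `b` has `deg ≤ 11` or two distinct contact neighbours of `deg ≤ 11`
(`word_reachable_end_two_payers`); `b` carries the invariant `P (b, κ)` for some well-formed `κ`; and `q` carries a
well-formed word `κ̃` MOVING to `b` in the format of LEMMA X (`…EndUniqueMulti`: full shell with `b = q + d`, or a twin
reading with a cross `b = q − R_m d` or a glide `b = q + d`, `d = F κ̃ (u κ̃)`).  Distinct ends give distinct pairs
(`word_reached_pred_ne`), so `#T` is the number of ends; the pairs of SEVERAL families are then pairwise distinct by
LEMMA X and all fit into the one capacity bound `card_endPairs_le_payers` (`…PayerPairCount`).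

WHAT THIS IS NOT: not the stub; the multi-root/two-sided assembly is the next brick; F-C1 not moved.
-/

noncomputable section

namespace Summit.Ventures.Crystal3D.Theorems

open Summit.Ventures.Crystal3D Finset
open Literature.MathematicalPhysics.StatisticalMechanics (fccStacking)
open scoped InnerProductSpace

section Instance

variable {X : Finset (EuclideanSpace ℝ (Fin 3))}
  {F : List (EuclideanSpace ℝ (Fin 3)) → (EuclideanSpace ℝ (Fin 3) ≃ₗᵢ[ℝ] EuclideanSpace ℝ (Fin 3))}
  {u : List (EuclideanSpace ℝ (Fin 3)) → EuclideanSpace ℝ (Fin 3)}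
  {WF : List (EuclideanSpace ℝ (Fin 3)) → Prop}
  {next : List (EuclideanSpace ℝ (Fin 3)) → EuclideanSpace ℝ (Fin 3) → List (EuclideanSpace ℝ (Fin 3))}
  {P₁ P' P₂ : Finset (EuclideanSpace ℝ (Fin 3))} {t₁ t₂ : EuclideanSpace ℝ (Fin 3)} {R₀ h ρ : ℝ}

open scoped Classical in
/-- **The end pairs of one word family, certified-state top exclusion.**  See the module docstring. -/
theorem word_family_endPairs_excl {δ : ℝ} (hg : KissingGap δ) (hc : KissingClassification δ)
    (hX : ∀ p ∈ X, ∀ q ∈ X, p ≠ q → 1 ≤ dist p q)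
    (hFc : ∀ μ κ, F (μ :: κ) = ((ℝ ∙ μ)ᗮ.reflection).trans (F κ))
    (hu : ∀ κ, u κ ∈ fccSlots) (huc : ∀ μ κ, u (μ :: κ) = -u κ)
    (hWF0 : WF [])
    (hWFc : ∀ μ κ, WF (μ :: κ) ↔ (WF κ ∧ ‖μ‖ = 1 ∧
      (∀ w ∈ fccSlots, ⟪w, μ⟫_ℝ = 0 ∨ ⟪w, μ⟫_ℝ = Real.sqrt (2 / 3) ∨ ⟪w, μ⟫_ℝ = -Real.sqrt (2 / 3)) ∧
      ⟪u κ, μ⟫_ℝ = Real.sqrt (2 / 3) ∧ ∀ μ' κ', κ = μ' :: κ' → μ' ≠ -μ))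
    (hnext_pop : ∀ μ κ' (m : EuclideanSpace ℝ (Fin 3)), (F (μ :: κ')).symm m = -μ → next (μ :: κ') m = κ')
    (hnext_push : ∀ κ (m : EuclideanSpace ℝ (Fin 3)), (∀ μ κ', κ = μ :: κ' → (F κ).symm m ≠ -μ) →
      next κ m = (F κ).symm m :: κ)
    -- the top grain's frame and the state invariant
    (G₂ : EuclideanSpace ℝ (Fin 3) ≃ₗᵢ[ℝ] EuclideanSpace ℝ (Fin 3))
    {P : EuclideanSpace ℝ (Fin 3) × List (EuclideanSpace ℝ (Fin 3)) → Prop}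
    (hPfull : ∀ (b : EuclideanSpace ℝ (Fin 3)) (κ : List (EuclideanSpace ℝ (Fin 3))), WF κ →
      P (b, κ) → P (b + F κ (u κ), κ))
    (hPcross : ∀ (b : EuclideanSpace ℝ (Fin 3)) (κ : List (EuclideanSpace ℝ (Fin 3))) (m : EuclideanSpace ℝ (Fin 3)),
      WF κ → WF (next κ m) → P (b, κ) → P (b + F (next κ m) (u (next κ m)), next κ m))
    (hPexcl0 : ∀ (b : EuclideanSpace ℝ (Fin 3)) (κ : List (EuclideanSpace ℝ (Fin 3))), WF κ → P (b, κ) → b ∈ P₂ →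
      (∀ w ∈ fccSlots, b + G₂ w ∈ X) →
      (∃ a ∈ fccSlots, ∃ a' ∈ fccSlots, ∃ a'' ∈ fccSlots,
        ⟪a, a'⟫_ℝ = 1 / 2 ∧ ⟪a, a''⟫_ℝ = 1 / 2 ∧ ⟪a', a''⟫_ℝ = 1 / 2 ∧
        b + F κ a ∈ X ∧ b + F κ a' ∈ X ∧ b + F κ a'' ∈ X) → False)
    (hup : 0 < (F [] (u [])) 2)
    -- the cell
    (hR₀ : 3 ≤ R₀) (hρ : R₀ ≤ ρ)
    (hcell : ∀ p ∈ X, -(2 * R₀) ≤ p 2 ∧ p 2 ≤ h + 2 * R₀ ∧ p 0 ^ 2 + p 1 ^ 2 ≤ ρ ^ 2)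
    (hP₁X : P₁ ⊆ X) (hP₂X : P₂ ⊆ X)
    (hP₁ : ∀ p, p ∈ P₁ ↔ (p ∈ (fun q => F [] q + t₁) '' fccStacking 1 (Real.sqrt (2 / 3)) ∧
      -(2 * R₀) ≤ p 2 ∧ p 2 ≤ -R₀ ∧ p 0 ^ 2 + p 1 ^ 2 ≤ ρ ^ 2))
    (hP' : ∀ p, p ∈ P' ↔ (p ∈ (fun q => F [] q + t₁) '' fccStacking 1 (Real.sqrt (2 / 3)) ∧
      -(2 * R₀) + 1 ≤ p 2 ∧ p 2 ≤ -R₀ - 1 ∧ p 0 ^ 2 + p 1 ^ 2 ≤ (ρ - 1) ^ 2))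
    (hP'full : ∀ p ∈ P', ∀ w ∈ fccSlots, p + F [] w ∈ X)
    (hPsrc : ∀ p ∈ P', P (p + F [] (u []), []))
    (hP₂ : ∀ p, p ∈ P₂ ↔ (p ∈ (fun q => G₂ q + t₂) '' fccStacking 1 (Real.sqrt (2 / 3)) ∧
      h + R₀ ≤ p 2 ∧ p 2 ≤ h + 2 * R₀ ∧ p 0 ^ 2 + p 1 ^ 2 ≤ ρ ^ 2)) :
    ∃ T : Finset (EuclideanSpace ℝ (Fin 3) × EuclideanSpace ℝ (Fin 3)),
      (P'.filter fun p => (∀ w ∈ fccSlots, p + F [] w ∈ X) ∧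
          -R₀ - 1 < (p + F [] (u [])) 2 ∧ (p + F [] (u [])) 2 < h + R₀ + 1).card ≤
        T.card +
        220 * (X.filter fun s => h + R₀ + 1 ≤ s 2 ∧ s 2 ≤ h + R₀ + 1 + 1 ∧ (ρ - 2) ^ 2 < s 0 ^ 2 + s 1 ^ 2).card +
        220 * (X.filter fun s => -R₀ - 1 - 1 ≤ s 2 ∧ s 2 < -R₀ - 1 ∧ (ρ - 1) ^ 2 < s 0 ^ 2 + s 1 ^ 2).card ∧
      (∀ bq ∈ T, bq.1 ∈ X ∧ bq.2 ∈ X ∧ dist bq.1 bq.2 = 1 ∧ -R₀ - 1 ≤ bq.1 2 ∧ bq.1 2 < h + R₀ + 1) ∧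
      (∀ bq ∈ T, (X.filter fun q => dist bq.1 q = 1).card ≤ 11 ∨
        ∃ z₁ ∈ X, ∃ z₂ ∈ X, z₁ ≠ z₂ ∧ dist bq.1 z₁ = 1 ∧ dist bq.1 z₂ = 1 ∧
          (X.filter fun q => dist z₁ q = 1).card ≤ 11 ∧ (X.filter fun q => dist z₂ q = 1).card ≤ 11) ∧
      (∀ bq ∈ T, ∃ κ, WF κ ∧ P (bq.1, κ)) ∧
      (∀ bq ∈ T, ∃ κ, WF κ ∧
        (((∀ w ∈ fccSlots, bq.2 + F κ w ∈ X) ∧ bq.1 = bq.2 + F κ (u κ)) ∨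
          ∃ m : EuclideanSpace ℝ (Fin 3), ‖m‖ = 1 ∧
            (∀ w ∈ fccSlots, ⟪F κ w, m⟫_ℝ = 0 ∨ ⟪F κ w, m⟫_ℝ = Real.sqrt (2 / 3) ∨ ⟪F κ w, m⟫_ℝ = -Real.sqrt (2 / 3)) ∧
            (∀ w ∈ fccSlots, ⟪F κ w, m⟫_ℝ ≤ 0 → bq.2 + F κ w ∈ X) ∧
            (∀ w ∈ fccSlots, ⟪F κ w, m⟫_ℝ < 0 → bq.2 + (F κ w - (2 * ⟪F κ w, m⟫_ℝ) • m) ∈ X) ∧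
            (∀ w ∈ fccSlots, 0 < ⟪F κ w, m⟫_ℝ → bq.2 + F κ w ∉ X) ∧
            ((⟪F κ (u κ), m⟫_ℝ = Real.sqrt (2 / 3) ∧ bq.1 = bq.2 - (F κ (u κ) - (2 * ⟪F κ (u κ), m⟫_ℝ) • m)) ∨
              (⟪F κ (u κ), m⟫_ℝ = 0 ∧ bq.1 = bq.2 + F κ (u κ))))) := by
  -- the class data on the subtype of well-formed words
  set F' : {κ : List (EuclideanSpace ℝ (Fin 3)) // WF κ} →
      (EuclideanSpace ℝ (Fin 3) ≃ₗᵢ[ℝ] EuclideanSpace ℝ (Fin 3)) := fun κ => F κ.1 with hF'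
  set d' : {κ : List (EuclideanSpace ℝ (Fin 3)) // WF κ} → EuclideanSpace ℝ (Fin 3) :=
    fun κ => F κ.1 (u κ.1) with hd'
  set next' : {κ : List (EuclideanSpace ℝ (Fin 3)) // WF κ} → EuclideanSpace ℝ (Fin 3) →
      {κ : List (EuclideanSpace ℝ (Fin 3)) // WF κ} := fun κ m =>
    @dite _ (WF (next κ.1 m)) (Classical.propDecidable _) (fun hw => ⟨next κ.1 m, hw⟩) (fun _ => κ) with hnext'
  set root : {κ : List (EuclideanSpace ℝ (Fin 3)) // WF κ} := ⟨[], hWF0⟩ with hroot_def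
  -- the class change along a crossing normal
  have hspec : ∀ (κ : {κ : List (EuclideanSpace ℝ (Fin 3)) // WF κ}) (m : EuclideanSpace ℝ (Fin 3)), ‖m‖ = 1 →
      (∀ w ∈ fccSlots, ⟪F' κ w, m⟫_ℝ = 0 ∨ ⟪F' κ w, m⟫_ℝ = Real.sqrt (2 / 3) ∨ ⟪F' κ w, m⟫_ℝ = -Real.sqrt (2 / 3)) →
      ⟪d' κ, m⟫_ℝ = Real.sqrt (2 / 3) →
      (next' κ m).1 = next κ.1 m ∧ (∀ x, F (next κ.1 m) x = F κ.1 x - (2 * ⟪F κ.1 x, m⟫_ℝ) • m) ∧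
        ⟪F (next κ.1 m) (u (next κ.1 m)), m⟫_ℝ = Real.sqrt (2 / 3) ∧ next (next κ.1 m) m = κ.1 := by
    intro κ m hm hmenu hdm
    obtain ⟨hwf, hfr, hdir, hinv⟩ := word_next_spec hFc huc hWFc hnext_pop hnext_push κ.2 hm hmenu hdm
    refine ⟨?_, hfr, hdir, hinv⟩
    simp only [hnext']
    rw [dif_pos hwf]
  have hmirror : ∀ (κ : {κ : List (EuclideanSpace ℝ (Fin 3)) // WF κ}) (m : EuclideanSpace ℝ (Fin 3)), ‖m‖ = 1 →
      (∀ w ∈ fccSlots, ⟪F' κ w, m⟫_ℝ = 0 ∨ ⟪F' κ w, m⟫_ℝ = Real.sqrt (2 / 3) ∨ ⟪F' κ w, m⟫_ℝ = -Real.sqrt (2 / 3)) →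
      ⟪d' κ, m⟫_ℝ = Real.sqrt (2 / 3) → ∀ x, F' (next' κ m) x = F' κ x - (2 * ⟪F' κ x, m⟫_ℝ) • m := by
    intro κ m hm hmenu hdm x
    obtain ⟨h1, hfr, -, -⟩ := hspec κ m hm hmenu hdm
    show F (next' κ m).1 x = F κ.1 x - (2 * ⟪F κ.1 x, m⟫_ℝ) • m
    rw [h1]; exact hfr x
  have hinv : ∀ (κ : {κ : List (EuclideanSpace ℝ (Fin 3)) // WF κ}) (m : EuclideanSpace ℝ (Fin 3)), ‖m‖ = 1 →
      (∀ w ∈ fccSlots, ⟪F' κ w, m⟫_ℝ = 0 ∨ ⟪F' κ w, m⟫_ℝ = Real.sqrt (2 / 3) ∨ ⟪F' κ w, m⟫_ℝ = -Real.sqrt (2 / 3)) →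
      ⟪d' κ, m⟫_ℝ = Real.sqrt (2 / 3) → next' (next' κ m) m = κ := by
    intro κ m hm hmenu hdm
    obtain ⟨h1, -, -, hback⟩ := hspec κ m hm hmenu hdm
    apply Subtype.ext
    have h2 : (next' (next' κ m) m).1 = next (next' κ m).1 m := by
      simp only [hnext']
      rw [dif_pos]
      rw [h1, hback]; exact κ.2
    rw [h2, h1, hback]
  have hdnext : ∀ (κ : {κ : List (EuclideanSpace ℝ (Fin 3)) // WF κ}) (m : EuclideanSpace ℝ (Fin 3)), ‖m‖ = 1 →
      (∀ w ∈ fccSlots, ⟪F' κ w, m⟫_ℝ = 0 ∨ ⟪F' κ w, m⟫_ℝ = Real.sqrt (2 / 3) ∨ ⟪F' κ w, m⟫_ℝ = -Real.sqrt (2 / 3)) →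
      ⟪d' κ, m⟫_ℝ = Real.sqrt (2 / 3) → ⟪d' (next' κ m), m⟫_ℝ = Real.sqrt (2 / 3) := by
    intro κ m hm hmenu hdm
    obtain ⟨h1, -, hdir, -⟩ := hspec κ m hm hmenu hdm
    show ⟪F (next' κ m).1 (u (next' κ m).1), m⟫_ℝ = Real.sqrt (2 / 3)
    rw [h1]; exact hdir
  have hd : ∀ κ : {κ : List (EuclideanSpace ℝ (Fin 3)) // WF κ}, ∃ u' ∈ fccSlots, d' κ = F' κ u' :=
    fun κ => ⟨u κ.1, hu κ.1, rfl⟩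
  have hdn : ∀ κ : {κ : List (EuclideanSpace ℝ (Fin 3)) // WF κ}, ∃ m : EuclideanSpace ℝ (Fin 3), ‖m‖ = 1 ∧
      (∀ w ∈ fccSlots, ⟪F' κ w, m⟫_ℝ = 0 ∨ ⟪F' κ w, m⟫_ℝ = Real.sqrt (2 / 3) ∨ ⟪F' κ w, m⟫_ℝ = -Real.sqrt (2 / 3)) ∧
      ⟪d' κ, m⟫_ℝ = Real.sqrt (2 / 3) := fun κ => exists_menuNormal_far (F κ.1) (hu κ.1)
  -- rigidity: the slot dozen determines the word
  have hinjK : ∀ κ κ' : {κ : List (EuclideanSpace ℝ (Fin 3)) // WF κ},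
      (F' κ : EuclideanSpace ℝ (Fin 3) → EuclideanSpace ℝ (Fin 3)) '' ↑fccSlots =
      (F' κ' : EuclideanSpace ℝ (Fin 3) → EuclideanSpace ℝ (Fin 3)) '' ↑fccSlots → κ = κ' :=
    fun κ κ' himg => Subtype.ext (word_eq_of_image_eq hFc huc hWFc κ.2 κ'.2 himg)
  have hrig : ∀ κ κ' : {κ : List (EuclideanSpace ℝ (Fin 3)) // WF κ},
      (∃ a ∈ fccSlots, ∃ a' ∈ fccSlots, ∃ a'' ∈ fccSlots,
        ⟪a, a'⟫_ℝ = 1 / 2 ∧ ⟪a, a''⟫_ℝ = 1 / 2 ∧ ⟪a', a''⟫_ℝ = 1 / 2 ∧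
        (∃ w ∈ fccSlots, F' κ' w = F' κ a) ∧ (∃ w ∈ fccSlots, F' κ' w = F' κ a') ∧
        (∃ w ∈ fccSlots, F' κ' w = F' κ a'')) → κ = κ' :=
    fun κ κ' htri => Subtype.ext (word_eq_of_triangle hFc huc hWFc κ.2 κ'.2 htri)
  -- glide non-return for well-formed words (19481-p1's `word_image_ne_glideMirror`, normal pulled back to the model)
  have hnoglide : ∀ (κ κ' : {κ : List (EuclideanSpace ℝ (Fin 3)) // WF κ}) (m : EuclideanSpace ℝ (Fin 3)), ‖m‖ = 1 →
      (∀ w ∈ fccSlots, ⟪F' κ w, m⟫_ℝ = 0 ∨ ⟪F' κ w, m⟫_ℝ = Real.sqrt (2 / 3) ∨ ⟪F' κ w, m⟫_ℝ = -Real.sqrt (2 / 3)) →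
      ⟪d' κ, m⟫_ℝ = 0 →
      (F' κ' : EuclideanSpace ℝ (Fin 3) → EuclideanSpace ℝ (Fin 3)) '' ↑fccSlots ≠
        (fun x => F' κ x - (2 * ⟪F' κ x, m⟫_ℝ) • m) '' ↑fccSlots := by
    intro κ κ' m hm hmenu hdm
    set μ : EuclideanSpace ℝ (Fin 3) := (F κ.1).symm m with hμ
    have hFμ : F κ.1 μ = m := by rw [hμ, LinearIsometryEquiv.apply_symm_apply]
    have hμ1 : ‖μ‖ = 1 := by rw [hμ, LinearIsometryEquiv.norm_map, hm]
    have hμmenu : ∀ w ∈ fccSlots, ⟪w, μ⟫_ℝ = 0 ∨ ⟪w, μ⟫_ℝ = Real.sqrt (2 / 3) ∨ ⟪w, μ⟫_ℝ = -Real.sqrt (2 / 3) := by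
      intro w hw; rw [← LinearIsometryEquiv.inner_map_map (F κ.1) w μ, hFμ]; exact hmenu w hw
    have horth : ⟪u κ.1, μ⟫_ℝ = 0 := by
      rw [← LinearIsometryEquiv.inner_map_map (F κ.1) (u κ.1) μ, hFμ]; exact hdm
    have key := word_image_ne_glideMirror hFc huc hWFc κ.2 hμ1 hμmenu horth κ'.2
    have e : (fun x => F κ.1 (x - (2 * ⟪x, μ⟫_ℝ) • μ)) = fun x => F' κ x - (2 * ⟪F' κ x, m⟫_ℝ) • m := by
      funext x
      show F κ.1 (x - (2 * ⟪x, μ⟫_ℝ) • μ) = F κ.1 x - (2 * ⟪F κ.1 x, m⟫_ℝ) • m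
      rw [← hFμ, mirror_conj]
    rw [e] at key; exact key
  -- the certified states and the move map
  obtain ⟨W, hW, hmult⟩ := exists_certified_states (F := F') (d := d') hX hinjK
  obtain ⟨f, hf_full, hf_cross, hf_glide⟩ := exists_word_move_map X F' d' next'
  -- the invariant, lifted to the subtype of well-formed words
  set Pw : EuclideanSpace ℝ (Fin 3) × {κ : List (EuclideanSpace ℝ (Fin 3)) // WF κ} → Prop :=
    fun v => P (v.1, v.2.1) with hPwdef
  have hPsrc' : ∀ p ∈ P', (∀ w ∈ fccSlots, p + F' root w ∈ X) → Pw (p + d' root, root) :=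
    fun p hp _ => hPsrc p hp
  have hPfull' : ∀ v ∈ W, Pw v → Pw (v.1 + d' v.2, v.2) := fun v _ hv => hPfull v.1 v.2.1 v.2.2 hv
  have hPcross' : ∀ v ∈ W, ∀ (m : EuclideanSpace ℝ (Fin 3)), ‖m‖ = 1 →
      (∀ w ∈ fccSlots, ⟪F' v.2 w, m⟫_ℝ = 0 ∨ ⟪F' v.2 w, m⟫_ℝ = Real.sqrt (2 / 3) ∨ ⟪F' v.2 w, m⟫_ℝ = -Real.sqrt (2 / 3)) →
      ⟪d' v.2, m⟫_ℝ = Real.sqrt (2 / 3) → Pw v → Pw (v.1 + d' (next' v.2 m), next' v.2 m) := by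
    intro v _ m hm hmenu hdm hv
    obtain ⟨h1, -, -, -⟩ := hspec v.2 m hm hmenu hdm
    have hwf : WF (next v.2.1 m) := by rw [← h1]; exact (next' v.2 m).2
    show P ((v.1 + F (next' v.2 m).1 (u (next' v.2 m).1), (next' v.2 m).1))
    rw [h1]
    exact hPcross v.1 v.2.1 m v.2.2 hwf hv
  have hPexcl : ∀ v ∈ W, Pw v → v.1 ∈ P₂ → (∀ w ∈ fccSlots, v.1 + G₂ w ∈ X) → False :=
    fun v hvW hv hvP hfull => hPexcl0 v.1 v.2.1 v.2.2 hv hvP hfull ((hW v).1 hvW).2.1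
  -- the abstract exact count under the state invariant
  have key := word_sources_le_exact (root := root) (G₂ := G₂) (P := Pw) hX hd hdn hmirror hinv hdnext hW
    hmult (fun v _ => hf_full v) (fun v _ => hf_cross v) (fun v _ => hf_glide v)
    (fun κ hκ => hrig κ root hκ) hup hPsrc' hPfull' hPcross' hPexcl hR₀ hρ hcell hP₁X hP₂X hP₁ hP' hP'full hP₂
  -- the reachable ends: each sits on an unsaturated ball of the window, at most 22 per ball
  set mov : EuclideanSpace ℝ (Fin 3) × {κ : List (EuclideanSpace ℝ (Fin 3)) // WF κ} → Prop := fun v =>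
    (∀ w ∈ fccSlots, v.1 + F' v.2 w ∈ X) ∨
      ∃ m : EuclideanSpace ℝ (Fin 3), ‖m‖ = 1 ∧
        (∀ w ∈ fccSlots, ⟪F' v.2 w, m⟫_ℝ = 0 ∨ ⟪F' v.2 w, m⟫_ℝ = Real.sqrt (2 / 3) ∨ ⟪F' v.2 w, m⟫_ℝ = -Real.sqrt (2 / 3)) ∧
        (∀ w ∈ fccSlots, ⟪F' v.2 w, m⟫_ℝ ≤ 0 → v.1 + F' v.2 w ∈ X) ∧
        (∀ w ∈ fccSlots, ⟪F' v.2 w, m⟫_ℝ < 0 → v.1 + (F' v.2 w - (2 * ⟪F' v.2 w, m⟫_ℝ) • m) ∈ X) ∧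
        (∀ w ∈ fccSlots, 0 < ⟪F' v.2 w, m⟫_ℝ → v.1 + F' v.2 w ∉ X) ∧
        (⟪d' v.2, m⟫_ℝ = Real.sqrt (2 / 3) ∨ ⟪d' v.2, m⟫_ℝ = 0) with hmov
  -- the end set of the abstract count, in membership form
  obtain ⟨E, hkey, hEmem⟩ : ∃ E : Finset (EuclideanSpace ℝ (Fin 3) × {κ : List (EuclideanSpace ℝ (Fin 3)) // WF κ}),
      (P'.filter fun p => (∀ w ∈ fccSlots, p + F [] w ∈ X) ∧
          -R₀ - 1 < (p + F [] (u [])) 2 ∧ (p + F [] (u [])) 2 < h + R₀ + 1).card ≤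
        E.card +
        220 * (X.filter fun s => h + R₀ + 1 ≤ s 2 ∧ s 2 ≤ h + R₀ + 1 + 1 ∧ (ρ - 2) ^ 2 < s 0 ^ 2 + s 1 ^ 2).card +
        220 * (X.filter fun s => -R₀ - 1 - 1 ≤ s 2 ∧ s 2 < -R₀ - 1 ∧ (ρ - 1) ^ 2 < s 0 ^ 2 + s 1 ^ 2).card ∧
      ∀ v, v ∈ E ↔ v ∈ W ∧ (-R₀ - 1 ≤ v.1 2 ∧ v.1 2 < h + R₀ + 1 ∧ ¬ mov v ∧ Pw v ∧
        ∃ u ∈ W, mov u ∧ f u = v) :=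
    ⟨_, key, fun v => by simp only [Finset.mem_filter, hmov]⟩
  -- the END PAIRS: (end ball, predecessor ball)
  set T : Finset (EuclideanSpace ℝ (Fin 3) × EuclideanSpace ℝ (Fin 3)) := E.image fun v => (v.1, v.1 - d' v.2) with hT
  have hTcard : T.card = E.card := by
    refine Finset.card_image_of_injOn ?_
    intro v₁ hv₁ v₂ hv₂ heq
    simp only [Prod.mk.injEq] at heq
    by_contra hne
    obtain ⟨-, -, -, -, -, u₁, hu₁, hm₁, hfu₁⟩ := (hEmem v₁).1 (mem_coe.1 hv₁)
    obtain ⟨-, -, -, -, -, u₂, hu₂, hm₂, hfu₂⟩ := (hEmem v₂).1 (mem_coe.1 hv₂)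
    rw [← hfu₁, ← hfu₂] at hne heq
    exact word_reached_pred_ne hX hd hdn hmirror hdnext hW (fun v _ => hf_full v) (fun v _ => hf_cross v)
      (fun v _ => hf_glide v) hrig hnoglide hu₁ hu₂ hm₁ hm₂ hne heq.2
  refine ⟨T, by rw [hTcard]; exact hkey, ?_, ?_, ?_, ?_⟩
  · -- balls, contact, window
    intro bq hbq
    obtain ⟨v, hv, rfl⟩ := mem_image.1 hbq
    obtain ⟨hvW, h1, h2, -, -, -⟩ := (hEmem v).1 hv
    obtain ⟨hbX, -, hpred⟩ := (hW v).1 hvW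
    obtain ⟨u', hu', hdu⟩ := hd v.2
    refine ⟨hbX, hpred, ?_, h1, h2⟩
    show dist v.1 (v.1 - d' v.2) = 1
    rw [dist_eq_norm, sub_sub_cancel, hdu, LinearIsometryEquiv.norm_map, norm_eq_one_of_mem_fccSlots hu']
  · -- the two-payer dichotomy
    intro bq hbq
    obtain ⟨v, hv, rfl⟩ := mem_image.1 hbq
    obtain ⟨hvW, -, -, hnm, -, u', hu'W, hum, hfu⟩ := (hEmem v).1 hv
    have hnm' : ¬ mov (f u') := by rw [hfu]; exact hnm
    rcases word_reachable_end_two_payers hg hc hX hd hdn hmirror hdnext hW (fun v _ => hf_full v)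
        (fun v _ => hf_cross v) (fun v _ => hf_glide v) hu'W hum hnm' with h11 | ⟨z₁, hz₁, z₂, hz₂, hne, hd₁, hd₂, hc₁, hc₂⟩
    · left; rw [hfu] at h11; exact h11
    · right; rw [hfu] at hd₁ hd₂; exact ⟨z₁, hz₁, z₂, hz₂, hne, hd₁, hd₂, hc₁, hc₂⟩
  · -- the invariant at the end ball
    intro bq hbq
    obtain ⟨v, hv, rfl⟩ := mem_image.1 hbq
    obtain ⟨-, -, -, -, hP, -⟩ := (hEmem v).1 hv
    exact ⟨v.2.1, v.2.2, hP⟩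
  · -- the moving predecessor, in the format of LEMMA X
    intro bq hbq
    obtain ⟨v, hv, rfl⟩ := mem_image.1 hbq
    obtain ⟨-, -, -, -, -, u', hu'W, hum, hfu⟩ := (hEmem v).1 hv
    obtain ⟨-, hback, -⟩ := word_move_target hd hdn hmirror hdnext hW (fun v _ => hf_full v) (fun v _ => hf_cross v)
      (fun v _ => hf_glide v) hu'W hum
    rw [hfu] at hback
    -- the pair is `((f u').1, u'.1)`
    have hpair : (v.1, v.1 - d' v.2) = ((f u').1, u'.1) := by rw [← hback, hfu]
    rw [hpair]
    refine ⟨u'.2.1, u'.2.2, ?_⟩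
    rcases hum with hfull | ⟨m, hm, hmenu, hown, hmir, hemp, hdm⟩
    · left
      refine ⟨hfull, ?_⟩
      rw [hf_full u' hfull]
    · right
      refine ⟨m, hm, hmenu, hown, hmir, hemp, ?_⟩
      rcases hdm with hcr | hgl
      · left
        refine ⟨hcr, ?_⟩
        rw [hf_cross u' m hm hmenu hown hmir hemp hcr]
        -- `d' (next' κ m) = −R_m (d' κ)`
        obtain ⟨h1, hfr, -, -⟩ := hspec u'.2 m hm hmenu hcr
        show u'.1 + F (next' u'.2 m).1 (u (next' u'.2 m).1) = u'.1 - (F u'.2.1 (u u'.2.1) - (2 * ⟪F u'.2.1 (u u'.2.1), m⟫_ℝ) • m)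
        rw [h1, hfr, word_u_next huc hnext_pop hnext_push, map_neg, inner_neg_left]
        module
      · right
        refine ⟨hgl, ?_⟩
        rw [hf_glide u' m hm hmenu hown hmir hemp hgl]

end Instance

end Summit.Ventures.Crystal3D.Theorems

end
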